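/-
Copyright (c) 2026 the pub-hodgecm-mathlib formalisation cell (harness21).  Prover seat hodgecm-mathlib-K2E1-p14 (g5), R90-TF section S8 «ContSpec-n½» (dealer R90-CS-plan (g4),
S8-R254 (3)(b) «`hT_k ∀ k` (S)»): the Tonelli ∕ absolute-convergence letter `hT_k` of ★ p864998 `hunfK_of_core_of_archContinuous` DISCHARGED for every continuous bounded pure tensor
`Φ_∞ ⊗ Φ_f` and EVERY base point `k ∈ G(𝔸)` (not only `k ∈ K_max`), for every Haar measure on `N(𝔸)` — the compact-closure fundamental domain the ★ majorant lemma wants is the Heisenberg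
domain ★, so no hypothesis on the caller's `𝓕` is added.
-/
import Summits.HodgeConjecture.HodgeConjecture.Theorems.K2E1ChiArchReadingOfContinuousBoundedU3   -- ★ p864998 (this seat): `hunfK_of_core_of_archContinuous` (the head whose letter `hT` is discharged here)
import Summits.HodgeConjecture.HodgeConjecture.Theorems.K2E1ChiIntertwinedCoeffKMaxCMThree          -- ★ (K2E1-p11): `integrable_flatSectionU_weylLongU_mul` (`v ↦ f_z^Φ(ι(w₀)·v·g)` integrable on `N(𝔸)`, `Re z > 2`, `Φ` continuous bounded)
import Literature.NumberTheory.Automorphic.UnitaryGroupHeisenbergFundamentalDomain                  -- ★ `isFundamentalDomain_heisFundamentalDomain`, `exists_isCompact_heisFundamentalDomain_subset`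
import HarnessLib

/-!
# K2·E1 ∕ R90·S8 — `K2E1ChiUnfoldingTonelliLetterU3`: THE LETTER `hT_k` OF `hunfK` DISCHARGED FOR CONTINUOUS BOUNDED `Φ_∞ ⊗ Φ_f`, ALL `k`

Cell `pub/hodgecm-mathlib`, crux h413 = `stmt-HodgeConjecture-24833`, route of record `HCCMUnconditional`; R90-TF section S8 «ContSpec-n½», road R2-χ₃ ((V) OF RECORD, K2E2-p12 (g10)'s letter
`hunfK`; S8-R254 (3)(b)).  THEOREMS ONLY (no `def`, no `instance`, no notation, no named-fact hypothesis, no `sorry`; default heartbeats); lane `--supports stmt-HodgeConjecture-24833 --as helper`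
(count-neutral).  Closes no socket.

THE MATHEMATICS ([MoeglinWaldspurger1995] II.1.5–II.1.7; [GelbartPiatetskiShapiroRallis1987] Part A §3; [Rogawski1990] §2.1; [BorelJacquet1979] §4.1).  ★ p864998's `hunfK_of_core_of_archContinuous`
unfolds the middle coefficient at every `k ∈ K_max` MODULO, per `k`, the letter `hT_k`: «`v ↦ f_z^{Φ_∞⊗Φ_f}(ι(w₀)·v·k)` is `ν`-integrable on `N(𝔸_{L⁺})` for `Re z > 2`» (Tonelli for the unfolding).
For a CONTINUOUS BOUNDED section `Φ` this is the Godement majorant: `|f_z^Φ(g)| ≤ ‖Φ‖_∞ · H(g)^{Re z}` (★ `norm_flatSectionU_le`) and `v ↦ H(ι(w₀) v g)^{Re z}` is integrable on `N(𝔸)` for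
`Re z > 2` (★ `integrable_borelHeight_weylLongU_mul_rpow_cm_three`, packaged as ★ `integrable_flatSectionU_weylLongU_mul`).  That ★ lemma asks for a fundamental domain of `N(F)∖N(𝔸)` with
COMPACT CLOSURE for the given Haar measure; the Heisenberg domain `𝓕_N = u(D_E × D_E⁻)` (★ `isFundamentalDomain_heisFundamentalDomain`, for EVERY measure; ★ `exists_isCompact_heisFundamentalDomain_subset`)
is one, so the letter holds for every Haar `ν`, every continuous bounded `Φ` and EVERY `g ∈ G(𝔸)` — §1 `integrable_flatSectionU_weylLongU_mul_of_continuous_bounded`.  For the pure tensor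
`Φ(g) = Φ_∞(g_∞)·Φ_f(g_f)` with `Φ_∞`, `Φ_f` continuous and bounded (★ `continuous_archPart`, ★ `continuous_finPart`; bound `M·M′`) this is §2 **`hT_of_continuous_bounded`** — the letter
`hT` of ★ p864998 in its exact bytes, for all `k` — and §3 **`hunfK_of_core_of_continuous_bounded`** is ★ `hunfK_of_core_of_archContinuous` with `hT` DISCHARGED: the hypotheses gained are
`hΦfc : Continuous Φf`, `hΦfM : ‖Φf‖ ≤ M′`; what stays visible per `k`: the finite pure-tensor reading `hΩ` ((W)-core), `hfin_k`, and the good-place tokens `hin`, `hsp`.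
HONEST LABEL: HC_CM is proved only modulo the 7 printed citations (2 remaining named inputs: hLiu418 = `stmt-HodgeConjecture-24832`, h413 = `stmt-HodgeConjecture-24833`) until rung 0
closes; REL ≠ ★ ≠ BUILT; this file asserts no named fact and closes no socket; after it `hunfK` = ★ MODULO, per `k`, the (W)-core reading `hΩ`, `hfin_k` and the tokens, for every continuous
bounded `Φ_∞ ⊗ Φ_f`; count-neutral.

## References
* [MoeglinWaldspurger1995] C. Mœglin, J.-L. Waldspurger, *Spectral Decomposition and Eisenstein Series* (1995): II.1.5 (Godement majorant, absolute convergence), II.1.7 (unfolding).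
* [GelbartPiatetskiShapiroRallis1987] S. Gelbart, I. Piatetski-Shapiro, S. Rallis, *Explicit Constructions of Automorphic L-Functions*, LNM 1254 (1987): Part A §3.
* [Rogawski1990] J. D. Rogawski, *Automorphic Representations of Unitary Groups in Three Variables*, Ann. of Math. Stud. 123 (1990): §2.1 (the Heisenberg group, `N(F)∖N(𝔸)` compact).
* [BorelJacquet1979] A. Borel, H. Jacquet, *Automorphic forms and automorphic representations*, Corvallis PSPM 33.1 (1979): §4.1 (`g = g_∞·g_f`).
* [Langlands1976] R. P. Langlands, *On the Functional Equations Satisfied by Eisenstein Series*, LNM 544 (1976): Appendix.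
-/

set_option autoImplicit false
set_option linter.dupNamespace false -- the mandated namespace repeats `HodgeConjecture.HodgeConjecture`

noncomputable section

open MeasureTheory MeasureTheory.Measure NumberField NumberField.InfinitePlace NumberField.mixedEmbedding IsDedekindDomain Filter
open scoped NNReal ENNReal
open Literature.NumberTheory.Automorphic Literature.NumberTheory.Automorphic.UnitaryGroup Literature.NumberTheory.GaloisRepresentations AdelicGroupData
open Literature.NumberTheory.GaloisRepresentations.IsNonarchimedeanLocalField Literature.NumberTheory.LFunctions
open Literature.NumberTheory.Automorphic.Arthur2013.Leaves.TECR
open Summit.HodgeConjecture.HodgeConjecture.Cruxes.H413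
open Summit.HodgeConjecture.HodgeConjecture.Cruxes.H413.K2E1BorelEisensteinU
open Summit.HodgeConjecture.HodgeConjecture.Cruxes.H413.K2E1CharacterEisensteinU3PairDefs
open Summit.HodgeConjecture.HodgeConjecture.Cruxes.H413.K2E1ChiUnfoldingConstantsOfRecordU3 (unfoldingHaarConst)
open Summit.HodgeConjecture.HodgeConjecture.Cruxes.H413.K2E1ChiArchAmplitudeOfKTypeVectorU3 (differentiableOn_chiAmplitude_three_of_norm_le)
open Summit.HodgeConjecture.HodgeConjecture.Cruxes.H413.K2E1ChiUnfoldingHolomorphicAmplitudeU3 (unfolding_eq_ratio_mul_amplitude_of_letters)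
open Summit.HodgeConjecture.HodgeConjecture.Cruxes.H413.K2E1ChiMidBlockUnfoldingAtKmaxU3 (flatSectionU_archFin_bigCell_mul_of_mem_Kmax)
open Summit.HodgeConjecture.HodgeConjecture.Cruxes.H413.K2E1ChiArchReadingOfContinuousBoundedU3 (hunfK_of_core_of_archContinuous)
open Summit.HodgeConjecture.HodgeConjecture.Cruxes.H413.K2E1ChiIntertwinedCoeffKMaxCMThree (integrable_flatSectionU_weylLongU_mul)

namespace Summit.HodgeConjecture.HodgeConjecture.Cruxes.H413.K2E1ChiUnfoldingTonelliLetterU3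

variable (L : Type) [Field L] [NumberField L] [IsCMField L] (hc : IsCMField.complexConj L * IsCMField.complexConj L = 1)
  {δ : L} (hcδ : IsCMField.complexConj L δ = -δ) (hδ : δ ≠ 0) {d : ↥(maximalRealSubfield L)} (hd : δ * δ = algebraMap ↥(maximalRealSubfield L) L d)

/-! ## §1 The Godement majorant letter for a continuous bounded section, any base point, any Haar measure on `N(𝔸)` -/

section Letter

variable [MeasurableSpace (quasiSplit (↥(maximalRealSubfield L)) L (IsCMField.complexConj L) 3).Adelic] [BorelSpace (quasiSplit (↥(maximalRealSubfield L)) L (IsCMField.complexConj L) 3).Adelic]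
  [MeasurableSpace (AdeleRing (𝓞 L) L)] [BorelSpace (AdeleRing (𝓞 L) L)]

include hc in
/-- **`v ↦ f_z^Φ(ι(w₀)·v·g)` IS INTEGRABLE ON `N(𝔸_{L⁺})` for `Re z > 2`, `Φ` continuous bounded, `g ∈ G(𝔸)` arbitrary, `ν` any Haar measure** — ★ `integrable_flatSectionU_weylLongU_mul` with its
compact-closure fundamental domain supplied by the Heisenberg domain (★ `isFundamentalDomain_heisFundamentalDomain hc ν`, ★ `exists_isCompact_heisFundamentalDomain_subset`).
[cite: MoeglinWaldspurger1995, II.1.5] [cite: Rogawski1990, §2.1] -/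
theorem integrable_flatSectionU_weylLongU_mul_of_continuous_bounded (ν : Measure ↥(adelicUnipotent ↥(maximalRealSubfield L) L (IsCMField.complexConj L) 3)) [ν.IsHaarMeasure]
    {Φ : (quasiSplit (↥(maximalRealSubfield L)) L (IsCMField.complexConj L) 3).Adelic → ℂ} (hΦc : Continuous Φ) {M : ℝ} (hΦM : ∀ x, ‖Φ x‖ ≤ M) {z : ℂ} (hz : 2 < z.re) (g : (quasiSplit (↥(maximalRealSubfield L)) L (IsCMField.complexConj L) 3).Adelic) :
    Integrable (fun v : ↥(adelicUnipotent ↥(maximalRealSubfield L) L (IsCMField.complexConj L) 3) => flatSectionU Φ z ((quasiSplit (↥(maximalRealSubfield L)) L (IsCMField.complexConj L) 3).toAdelic (weylLongU ((IsCMField.complexConj L : L ≃ₐ[↥(maximalRealSubfield L)] L) : L →+* L) (rfl : (StdForm.antidiagonal 3).over L = (StdForm.antidiagonal 3).over L)) * ((v : (quasiSplit (↥(maximalRealSubfield L)) L (IsCMField.complexConj L) 3).Adelic) * g))) ν := by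
  obtain ⟨C, hC, hsub⟩ := exists_isCompact_heisFundamentalDomain_subset (F := ↥(maximalRealSubfield L)) (E := L) (c := IsCMField.complexConj L) hc
  exact integrable_flatSectionU_weylLongU_mul L ν (isFundamentalDomain_heisFundamentalDomain (F := ↥(maximalRealSubfield L)) (E := L) (c := IsCMField.complexConj L) hc ν)
    (hC.closure_of_subset hsub) hΦc hΦM hz g

/-! ## §2 The letter `hT_k` of ★ `hunfK_of_core_of_archContinuous` for a continuous bounded pure tensor `Φ_∞ ⊗ Φ_f`, all `k` -/

include hc in
/-- **`hT_of_continuous_bounded` — THE LETTER `hT` OF ★ p864998 IN ITS BYTES, FOR ALL `k ∈ G(𝔸)`**: for `Φ_∞`, `Φ_f` continuous and bounded, the section `g ↦ Φ_∞(g_∞)·Φ_f(g_f)` is continuous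
(★ `continuous_archPart`, ★ `continuous_finPart`) and bounded by `M·M′`, so §1 applies. [cite: MoeglinWaldspurger1995, II.1.5, II.1.7] [cite: BorelJacquet1979, §4.1] -/
theorem hT_of_continuous_bounded (ν : Measure ↥(adelicUnipotent ↥(maximalRealSubfield L) L (IsCMField.complexConj L) 3)) [ν.IsHaarMeasure]
    (Φinf : ↥(arch (↥(maximalRealSubfield L)) L (IsCMField.complexConj L) 3 ((StdForm.antidiagonal 3).over L)) → ℂ) (hΦinfc : Continuous Φinf) {M : ℝ} (hΦinfM : ∀ y, ‖Φinf y‖ ≤ M)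
    (Φf : ↥(finAdelic (↥(maximalRealSubfield L)) L (IsCMField.complexConj L) 3 ((StdForm.antidiagonal 3).over L)) → ℂ) (hΦfc : Continuous Φf) {M' : ℝ} (hΦfM : ∀ y, ‖Φf y‖ ≤ M') :
    ∀ k : (quasiSplit (↥(maximalRealSubfield L)) L (IsCMField.complexConj L) 3).Adelic, ∀ z : ℂ, 2 < z.re → Integrable (fun v : ↥(adelicUnipotent ↥(maximalRealSubfield L) L (IsCMField.complexConj L) 3) => flatSectionU (fun g : (quasiSplit (↥(maximalRealSubfield L)) L (IsCMField.complexConj L) 3).Adelic => Φinf (archPart (↥(maximalRealSubfield L)) L (IsCMField.complexConj L) 3 ((StdForm.antidiagonal 3).over L) g) * Φf (finPart (↥(maximalRealSubfield L)) L (IsCMField.complexConj L) 3 ((StdForm.antidiagonal 3).over L) g)) z ((quasiSplit (↥(maximalRealSubfield L)) L (IsCMField.complexConj L) 3).toAdelic (weylLongU ((IsCMField.complexConj L : L ≃ₐ[↥(maximalRealSubfield L)] L) : L →+* L) (rfl : (StdForm.antidiagonal 3).over L = (StdForm.antidiagonal 3).over L)) * ((v : (quasiSplit (↥(maximalRealSubfield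 L)) L (IsCMField.complexConj L) 3).Adelic) * k))) ν :=
  fun k _ hz => integrable_flatSectionU_weylLongU_mul_of_continuous_bounded L hc ν
    ((hΦinfc.comp (continuous_archPart (↥(maximalRealSubfield L)) L (IsCMField.complexConj L) 3 ((StdForm.antidiagonal 3).over L))).mul
      (hΦfc.comp (continuous_finPart (↥(maximalRealSubfield L)) L (IsCMField.complexConj L) 3 ((StdForm.antidiagonal 3).over L)))) (M := M * M')
    (fun x => (norm_mul_le _ _).trans (mul_le_mul (hΦinfM (archPart (↥(maximalRealSubfield L)) L (IsCMField.complexConj L) 3 ((StdForm.antidiagonal 3).over L) x)) (hΦfM (finPart (↥(maximalRealSubfield L)) L (IsCMField.complexConj L) 3 ((StdForm.antidiagonal 3).over L) x)) (norm_nonneg _) ((norm_nonneg _).trans (hΦinfM (archPart (↥(maximalRealSubfield L)) L (IsCMField.complexConj L) 3 ((StdForm.antidiagonal 3).over L) x))))) hz k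

end Letter

/-! ## §3 HEAD: ★ `hunfK_of_core_of_archContinuous` with `hT` discharged -/

section Heads

variable [MeasurableSpace (quasiSplit (↥(maximalRealSubfield L)) L (IsCMField.complexConj L) 3).Adelic] [BorelSpace (quasiSplit (↥(maximalRealSubfield L)) L (IsCMField.complexConj L) 3).Adelic]
  [MeasurableSpace (AdeleRing (𝓞 L) L)] [BorelSpace (AdeleRing (𝓞 L) L)]
  [MeasurableSpace (AdeleRing (𝓞 ↥(maximalRealSubfield L)) ↥(maximalRealSubfield L))] [BorelSpace (AdeleRing (𝓞 ↥(maximalRealSubfield L)) ↥(maximalRealSubfield L))]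
  [MeasurableSpace (InfiniteAdeleRing L)] [BorelSpace (InfiniteAdeleRing L)]
  [MeasurableSpace (InfiniteAdeleRing ↥(maximalRealSubfield L))] [BorelSpace (InfiniteAdeleRing ↥(maximalRealSubfield L))]
  [MeasurableSpace (FiniteAdeleRing (𝓞 L) L)] [BorelSpace (FiniteAdeleRing (𝓞 L) L)]
  [MeasurableSpace (FiniteAdeleRing (𝓞 ↥(maximalRealSubfield L)) ↥(maximalRealSubfield L))] [BorelSpace (FiniteAdeleRing (𝓞 ↥(maximalRealSubfield L)) ↥(maximalRealSubfield L))]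
  [∀ v : HeightOneSpectrum (𝓞 ↥(maximalRealSubfield L)), MeasurableSpace (v.adicCompletion ↥(maximalRealSubfield L))] [∀ v : HeightOneSpectrum (𝓞 ↥(maximalRealSubfield L)), BorelSpace (v.adicCompletion ↥(maximalRealSubfield L))]
  (ν : Measure ↥(adelicUnipotent ↥(maximalRealSubfield L) L (IsCMField.complexConj L) 3)) [ν.IsHaarMeasure]
  {𝓕 : Set ↥(adelicUnipotent ↥(maximalRealSubfield L) L (IsCMField.complexConj L) 3)} (h𝓕 : IsFundamentalDomain ↥(rationalUnipotent ↥(maximalRealSubfield L) L (IsCMField.complexConj L) 3) 𝓕 ν)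
  (μE : Measure (AdeleRing (𝓞 L) L)) [μE.IsAddHaarMeasure] (μE₁ : Measure (InfiniteAdeleRing L)) [μE₁.IsAddHaarMeasure]
  (μE₂ : Measure (FiniteAdeleRing (𝓞 L) L)) [μE₂.IsAddHaarMeasure]
  (μF : Measure (AdeleRing (𝓞 ↥(maximalRealSubfield L)) ↥(maximalRealSubfield L))) [μF.IsAddHaarMeasure] (μF₁ : Measure (InfiniteAdeleRing ↥(maximalRealSubfield L))) [μF₁.IsAddHaarMeasure]
  (μF₂ : Measure (FiniteAdeleRing (𝓞 ↥(maximalRealSubfield L)) ↥(maximalRealSubfield L))) [μF₂.IsAddHaarMeasure]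
  (νv : ∀ v : HeightOneSpectrum (𝓞 ↥(maximalRealSubfield L)), Measure (v.adicCompletion ↥(maximalRealSubfield L))) [∀ v, (νv v).IsAddHaarMeasure]
  {φ : HeckeCharacter L} {ψ : HeckeCharacter ↥(maximalRealSubfield L)} (hφ : φ.IsUnitary) (hψ : (ψ * quadraticHeckeCharCM L).IsUnitary)
  (hres : ∀ x, φ (AdeleRing.ideleBaseChange ↥(maximalRealSubfield L) L x) = ψ x)

include hd h𝓕 μE μE₁ μF μF₁ hφ hψ hres in
/-- **HEAD — `hunfK_of_core_of_continuous_bounded`: `hunfK` FOR ALL `k ∈ K_max`, FOR A CONTINUOUS BOUNDED PURE TENSOR `Φ_∞ ⊗ Φ_f`, THE TONELLI LETTER `hT` DISCHARGED** — ★ p864998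
`hunfK_of_core_of_archContinuous` (all its hypotheses verbatim, minus `hT`, plus `hΦfc : Continuous Φf`, `hΦfM : ‖Φf‖ ≤ M′`) with `hT := hT_of_continuous_bounded` (§2).  Visible per `k`: the
finite pure-tensor reading `hΩ` ((W)-core), `hfin`, the good-place tokens `hin`, `hsp`.  K2E2-p12 (g10)'s letter `hunfK` in its binder shape.
[cite: MoeglinWaldspurger1995, II.1.5, II.1.7, IV.1.11] [cite: Langlands1976, Appendix] [cite: Rogawski1990, §13.9 p. 229] -/
theorem hunfK_of_core_of_continuous_bounded
    (Φinf : ↥(arch (↥(maximalRealSubfield L)) L (IsCMField.complexConj L) 3 ((StdForm.antidiagonal 3).over L)) → ℂ) (hΦinfc : Continuous Φinf) {M : ℝ} (hΦinfM : ∀ y, ‖Φinf y‖ ≤ M)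
    (Φf : ↥(finAdelic (↥(maximalRealSubfield L)) L (IsCMField.complexConj L) 3 ((StdForm.antidiagonal 3).over L)) → ℂ)
    (hΦfc : Continuous Φf) {M' : ℝ} (hΦfM : ∀ y, ‖Φf y‖ ≤ M')
    (S₀ : Finset (HeightOneSpectrum (𝓞 ↥(maximalRealSubfield L))))
    (hgood : ∀ v ∉ S₀, (Algebra.IsUnramifiedIn (𝓞 L) v.asIdeal ∧ Valued.v (2 : v.adicCompletion ↥(maximalRealSubfield L)) = 1 ∧
      ∀ w : PlacesOver L v, Valued.v (algebraMap L (LocalRing L v) δ w) = 1) ∧ ∀ w : PlacesOver L v, φ.IsUnramifiedAt w.1)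
    (ω : (quasiSplit (↥(maximalRealSubfield L)) L (IsCMField.complexConj L) 3).Adelic → ∀ v : HeightOneSpectrum (𝓞 ↥(maximalRealSubfield L)), (Fin 3 → v.adicCompletion ↥(maximalRealSubfield L)) → ℂ)
    (hωc : ∀ k ∈ ((standardMaximalCompactGL 3 L).comap (adelicVal (↥(maximalRealSubfield L)) L (IsCMField.complexConj L) 3 ((StdForm.antidiagonal 3).over L)) : Subgroup (quasiSplit (↥(maximalRealSubfield L)) L (IsCMField.complexConj L) 3).Adelic), ∀ z : ℂ, 2 < z.re → ∀ v, Continuous fun p : Fin 3 → v.adicCompletion ↥(maximalRealSubfield L) =>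
      ω k v p * (((∏ w' : PlacesOver L v, max 1 (max ((normAbs (w'.1.adicCompletion L) (quadraticLocalEquiv L v (IsCMField.complexConj L) hcδ hδ (p 0, p 1) w') : ℝ≥0) : ℝ)
              ((normAbs (w'.1.adicCompletion L) ((toLocalRing L v (p 2) * algebraMap L (LocalRing L v) δ -
                toLocalRing L v 2⁻¹ * (quadraticLocalEquiv L v (IsCMField.complexConj L) hcδ hδ (p 0, p 1) *
                  conjLocal L (IsCMField.complexConj L) v (quadraticLocalEquiv L v (IsCMField.complexConj L) hcδ hδ (p 0, p 1)))) w') : ℝ≥0) : ℝ))) : ℝ) : ℂ) ^ (-z))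
    (hωm : ∀ k ∈ ((standardMaximalCompactGL 3 L).comap (adelicVal (↥(maximalRealSubfield L)) L (IsCMField.complexConj L) 3 ((StdForm.antidiagonal 3).over L)) : Subgroup (quasiSplit (↥(maximalRealSubfield L)) L (IsCMField.complexConj L) 3).Adelic), ∀ v ∈ S₀, AEStronglyMeasurable (ω k v) (Measure.pi fun _ : Fin 3 => νv v)) (hωb : ∀ k ∈ ((standardMaximalCompactGL 3 L).comap (adelicVal (↥(maximalRealSubfield L)) L (IsCMField.complexConj L) 3 ((StdForm.antidiagonal 3).over L)) : Subgroup (quasiSplit (↥(maximalRealSubfield L)) L (IsCMField.complexConj L) 3).Adelic), ∀ v ∈ S₀, ∀ p, ‖ω k v p‖ ≤ 1)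
    (hω1 : ∀ k ∈ ((standardMaximalCompactGL 3 L).comap (adelicVal (↥(maximalRealSubfield L)) L (IsCMField.complexConj L) 3 ((StdForm.antidiagonal 3).over L)) : Subgroup (quasiSplit (↥(maximalRealSubfield L)) L (IsCMField.complexConj L) 3).Adelic), ∀ v ∉ S₀, ∀ p ∈ integralBox ↥(maximalRealSubfield L) (Fin 3) v, ω k v p = 1)
    (hΩ : ∀ k ∈ ((standardMaximalCompactGL 3 L).comap (adelicVal (↥(maximalRealSubfield L)) L (IsCMField.complexConj L) 3 ((StdForm.antidiagonal 3).over L)) : Subgroup (quasiSplit (↥(maximalRealSubfield L)) L (IsCMField.complexConj L) 3).Adelic), ∀ x : Fin 3 → FiniteAdeleRing (𝓞 ↥(maximalRealSubfield L)) ↥(maximalRealSubfield L),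
      Φf (finPart (↥(maximalRealSubfield L)) L (IsCMField.complexConj L) 3 ((StdForm.antidiagonal 3).over L) ((quasiSplit (↥(maximalRealSubfield L)) L (IsCMField.complexConj L) 3).toAdelic (weylLongU ((IsCMField.complexConj L : L ≃ₐ[↥(maximalRealSubfield L)] L) : L →+* L) (rfl : (StdForm.antidiagonal 3).over L = (StdForm.antidiagonal 3).over L)) * (((heisChart hc (((((0 : InfiniteAdeleRing L)), quadraticFiniteAdeleMap ↥(maximalRealSubfield L) L δ (x 0, x 1)) : AdeleRing (𝓞 L) L), traceZeroLine ↥(maximalRealSubfield L) L (IsCMField.complexConj L) hcδ hδ ((0, x 2) : AdeleRing (𝓞 ↥(maximalRealSubfield L)) ↥(maximalRealSubfield L)))) : ↥(adelicUnipotent ↥(maximalRealSubfield L) L (IsCMField.complexConj L) 3)) : (quasiSplit (↥(maximalRealSubfield L)) L (IsCMField.complexConj L) 3).Adelic)) * finPart (↥(maximalRealSubfield L)) L (IsCMField.complexConj L) 3 ((StdForm.antidiagonal 3).over L) k) = ∏ᶠ v : HeightOneSpectrum (𝓞 ↥(maximalRealSubfield L)), ω k v (fun i => x i v))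
    (hfin : ∀ k ∈ ((standardMaximalCompactGL 3 L).comap (adelicVal (↥(maximalRealSubfield L)) L (IsCMField.complexConj L) 3 ((StdForm.antidiagonal 3).over L)) : Subgroup (quasiSplit (↥(maximalRealSubfield L)) L (IsCMField.complexConj L) 3).Adelic), ∀ z : ℂ, 2 < z.re → Integrable (fun q : FiniteAdeleRing (𝓞 L) L × FiniteAdeleRing (𝓞 ↥(maximalRealSubfield L)) ↥(maximalRealSubfield L) =>
      (Φf (finPart (↥(maximalRealSubfield L)) L (IsCMField.complexConj L) 3 ((StdForm.antidiagonal 3).over L) ((quasiSplit (↥(maximalRealSubfield L)) L (IsCMField.complexConj L) 3).toAdelic (weylLongU ((IsCMField.complexConj L : L ≃ₐ[↥(maximalRealSubfield L)] L) : L →+* L) (rfl : (StdForm.antidiagonal 3).over L = (StdForm.antidiagonal 3).over L)) * (((heisChart hc (((((0 : InfiniteAdeleRing L)), q.1) : AdeleRing (𝓞 L) L), traceZeroLine ↥(maximalRealSubfield L) L (IsCMField.complexConj L) hcδ hδ ((0, q.2) : AdeleRing (𝓞 ↥(maximalRealSubfield L)) ↥(maximalRealSubfield L)))) : ↥(adelicUnipotent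 ↥(maximalRealSubfield L) L (IsCMField.complexConj L) 3)) : (quasiSplit (↥(maximalRealSubfield L)) L (IsCMField.complexConj L) 3).Adelic)) * finPart (↥(maximalRealSubfield L)) L (IsCMField.complexConj L) 3 ((StdForm.antidiagonal 3).over L) k) * ((((∏ᶠ w : HeightOneSpectrum (𝓞 L), max 1 (max ‖((((0 : InfiniteAdeleRing L)), q.1) : AdeleRing (𝓞 L) L).2 w‖₊ ‖(heisZ (c := IsCMField.complexConj L) ((((0 : InfiniteAdeleRing L)), q.1) : AdeleRing (𝓞 L) L) ((traceZeroLine ↥(maximalRealSubfield L) L (IsCMField.complexConj L) hcδ hδ ((0, q.2) : AdeleRing (𝓞 ↥(maximalRealSubfield L)) ↥(maximalRealSubfield L)) : traceZeroAdele ↥(maximalRealSubfield L) L (IsCMField.complexConj L)) : AdeleRing (𝓞 L) L)).2 w‖₊) : ℝ≥0) : ℝ) : ℂ) ^ (-z)))) (μE₂.prod μF₂))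
    (hin : ∀ k ∈ ((standardMaximalCompactGL 3 L).comap (adelicVal (↥(maximalRealSubfield L)) L (IsCMField.complexConj L) 3 ((StdForm.antidiagonal 3).over L)) : Subgroup (quasiSplit (↥(maximalRealSubfield L)) L (IsCMField.complexConj L) 3).Adelic), ∀ z : ℂ, 2 < z.re → ∀ v ∉ S₀, ∀ w : PlacesOver L v, IsCMField.complexConj L • w.1 = w.1 →
      ((Measure.pi fun _ : Fin 3 => νv v) (integralBox ↥(maximalRealSubfield L) (Fin 3) v)).toReal⁻¹ •
          ∫ p : Fin 3 → v.adicCompletion ↥(maximalRealSubfield L),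
            ω k v p * (((∏ w' : PlacesOver L v, max 1 (max ((normAbs (w'.1.adicCompletion L) (quadraticLocalEquiv L v (IsCMField.complexConj L) hcδ hδ (p 0, p 1) w') : ℝ≥0) : ℝ)
              ((normAbs (w'.1.adicCompletion L) ((toLocalRing L v (p 2) * algebraMap L (LocalRing L v) δ -
                toLocalRing L v 2⁻¹ * (quadraticLocalEquiv L v (IsCMField.complexConj L) hcδ hδ (p 0, p 1) *
                  conjLocal L (IsCMField.complexConj L) v (quadraticLocalEquiv L v (IsCMField.complexConj L) hcδ hδ (p 0, p 1)))) w') : ℝ≥0) : ℝ))) : ℝ) : ℂ) ^ (-z)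
            ∂(Measure.pi fun _ : Fin 3 => νv v) =
        (1 - φ.valueAtUniformizer w.1 * (v.residueCard : ℂ) ^ (-(2 * z))) * (1 + φ.valueAtUniformizer w.1 * (v.residueCard : ℂ) ^ (-(2 * z - 1))) /
          ((1 - φ.valueAtUniformizer w.1 * (v.residueCard : ℂ) ^ (-(2 * z - 2))) * (1 + φ.valueAtUniformizer w.1 * (v.residueCard : ℂ) ^ (-(2 * z - 2)))))
    (hsp : ∀ k ∈ ((standardMaximalCompactGL 3 L).comap (adelicVal (↥(maximalRealSubfield L)) L (IsCMField.complexConj L) 3 ((StdForm.antidiagonal 3).over L)) : Subgroup (quasiSplit (↥(maximalRealSubfield L)) L (IsCMField.complexConj L) 3).Adelic), ∀ z : ℂ, 2 < z.re → ∀ v ∉ S₀, ∀ w : PlacesOver L v, IsCMField.complexConj L • w.1 ≠ w.1 →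
      ((Measure.pi fun _ : Fin 3 => νv v) (integralBox ↥(maximalRealSubfield L) (Fin 3) v)).toReal⁻¹ •
          ∫ p : Fin 3 → v.adicCompletion ↥(maximalRealSubfield L),
            ω k v p * (((∏ w' : PlacesOver L v, max 1 (max ((normAbs (w'.1.adicCompletion L) (quadraticLocalEquiv L v (IsCMField.complexConj L) hcδ hδ (p 0, p 1) w') : ℝ≥0) : ℝ)
              ((normAbs (w'.1.adicCompletion L) ((toLocalRing L v (p 2) * algebraMap L (LocalRing L v) δ -
                toLocalRing L v 2⁻¹ * (quadraticLocalEquiv L v (IsCMField.complexConj L) hcδ hδ (p 0, p 1) *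
                  conjLocal L (IsCMField.complexConj L) v (quadraticLocalEquiv L v (IsCMField.complexConj L) hcδ hδ (p 0, p 1)))) w') : ℝ≥0) : ℝ))) : ℝ) : ℂ) ^ (-z)
            ∂(Measure.pi fun _ : Fin 3 => νv v) =
        (1 - φ.valueAtUniformizer w.1 * (v.residueCard : ℂ) ^ (-z)) * (1 - φ.valueAtUniformizer (PlacesOver.galInv (IsCMField.complexConj L) w).1 * (v.residueCard : ℂ) ^ (-z)) *
            (1 - φ.valueAtUniformizer w.1 * φ.valueAtUniformizer (PlacesOver.galInv (IsCMField.complexConj L) w).1 * (v.residueCard : ℂ) ^ (-(2 * z - 1))) /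
          ((1 - φ.valueAtUniformizer w.1 * (v.residueCard : ℂ) ^ (-(z - 1))) * (1 - φ.valueAtUniformizer (PlacesOver.galInv (IsCMField.complexConj L) w).1 * (v.residueCard : ℂ) ^ (-(z - 1))) *
            (1 - φ.valueAtUniformizer w.1 * φ.valueAtUniformizer (PlacesOver.galInv (IsCMField.complexConj L) w).1 * (v.residueCard : ℂ) ^ (-(2 * z - 2))))) :
    ∀ k ∈ ((standardMaximalCompactGL 3 L).comap (adelicVal (↥(maximalRealSubfield L)) L (IsCMField.complexConj L) 3 ((StdForm.antidiagonal 3).over L)) : Subgroup (quasiSplit (↥(maximalRealSubfield L)) L (IsCMField.complexConj L) 3).Adelic),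
      ∃ A : ℂ → ℂ, DifferentiableOn ℂ A {z : ℂ | 1 < z.re} ∧ ∀ z : ℂ, 2 < z.re →
        ((ν 𝓕).toReal⁻¹ : ℝ) • ∫ v : ↥(adelicUnipotent ↥(maximalRealSubfield L) L (IsCMField.complexConj L) 3), flatSectionU (fun g : (quasiSplit (↥(maximalRealSubfield L)) L (IsCMField.complexConj L) 3).Adelic => Φinf (archPart (↥(maximalRealSubfield L)) L (IsCMField.complexConj L) 3 ((StdForm.antidiagonal 3).over L) g) * Φf (finPart (↥(maximalRealSubfield L)) L (IsCMField.complexConj L) 3 ((StdForm.antidiagonal 3).over L) g)) z ((quasiSplit (↥(maximalRealSubfield L)) L (IsCMField.complexConj L) 3).toAdelic (weylLongU ((IsCMField.complexConj L : L ≃ₐ[↥(maximalRealSubfield L)] L) : L →+* L) (rfl : (StdForm.antidiagonal 3).over L = (StdForm.antidiagonal 3).over L)) * ((v : (quasiSplit (↥(maximalRealSubfield L)) L (IsCMField.complexConj L) 3).Adelic) * k)) ∂ν =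
          ((partialStandardL {w : HeightOneSpectrum (𝓞 L) | w.under (𝓞 ↥(maximalRealSubfield L)) ∈ (↑S₀ : Set (HeightOneSpectrum (𝓞 ↥(maximalRealSubfield L))))} (fun w => {φ.valueAtUniformizer w}) (z - 1) *
            partialStandardL (↑S₀ : Set (HeightOneSpectrum (𝓞 ↥(maximalRealSubfield L)))) (fun v => {(ψ * quadraticHeckeCharCM L).valueAtUniformizer v}) (2 * z - 2)) /
          (partialStandardL {w : HeightOneSpectrum (𝓞 L) | w.under (𝓞 ↥(maximalRealSubfield L)) ∈ (↑S₀ : Set (HeightOneSpectrum (𝓞 ↥(maximalRealSubfield L))))} (fun w => {φ.valueAtUniformizer w}) z *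
            partialStandardL (↑S₀ : Set (HeightOneSpectrum (𝓞 ↥(maximalRealSubfield L)))) (fun v => {(ψ * quadraticHeckeCharCM L).valueAtUniformizer v}) (2 * z - 1))) * A z :=
  hunfK_of_core_of_archContinuous L hc hcδ hδ hd ν h𝓕 μE μE₁ μE₂ μF μF₁ μF₂ νv hφ hψ hres Φinf hΦinfc hΦinfM Φf S₀ hgood ω hωc hωm hωb hω1 hΩ
    (fun k _ z hz => hT_of_continuous_bounded L hc ν Φinf hΦinfc hΦinfM Φf hΦfc hΦfM k z hz) hfin hin hsp

end Heads

end Summit.HodgeConjecture.HodgeConjecture.Cruxes.H413.K2E1ChiUnfoldingTonelliLetterU3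

end
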